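import Summits.BirchSwinnertonDyer.BirchSwinnertonDyer.Theorems.SylvesterTwoHeegnerIndexCMHalfPairPackage
import Literature.NumberTheory.EllipticCurves.KolyvaginClassLocalConditionCoprimeIndex
import HarnessLib

/-!
# (S9a) of leaf (L1) at `p ≡ 7 (mod 9)`, crux `UpperOffV0HSYPlus` (stmt-BirchSwinnertonDyer-19804): the HALF pair class
# `c′_B(ℓℓ′)` is SELMER AT `w ∣ 3`, GRANTED THE LOCAL TOWER FIXING at `w` (W2-d's input)

Skeleton VARIANT M 406ca288e244d392, stub `stub_layerL1Seven`; planner D507 (4), D510 («the w ∣ 3 conjunct of #24-seven: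
keep it a displayed hypothesis … unless a local TF clause in #17b/#18's currency genuinely discharges it»).  #24
`L1_of_cmFrameClasses_seven` asks, for `c_B(ℓℓ′)` only, the Selmer condition at the additive place `w ∣ 3` of `B = E_p`
(`B(K_w)[2] = B[2]`, `H¹(K_w, B[2]) ≠ 0` on this residue class; memo two §67.2 (W2-d)).  This file discharges it for the
HALF class from ONE displayed LOCAL datum, in the currency of k-ty1's
`JZero.kolyvaginClass_cubicTwist_chiComponent_mem_selmerLocalKer_of_isCoprime`: an OPEN subgroup `Φ ≤ Γ_{K_w}` of ODD
index whose elements act on the embedded `K[9pℓℓ′]` as `1` or as the tower-fixing automorphism `φ` (printed: `Φ` =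
preimage of `⟨φ_w⟩`, `φ_w = Art(ϖ_w) = σ_{−1}·e_ℓ·e_{ℓ′}`, index `#I_w = 9` — memo two §67.2 (W2-a)/(W2-d); a CELL
input, NOT proved and NOT in the tree).  Then `Φ` fixes `v_B` (both `1` and `φ` fix `∛3, ∛p`) and the pair point
`κ⁻¹ ι_e(D_ℓ D_{ℓ′} y)` (`φ` fixes `y`, #S7 `pointGalHom_derivOp_derivOp_eq_of_apply_eq`), so the class is Selmer at `w`.

Theorems only; no `def`, no `sorry`, no new `Prop`; `set_option maxHeartbeats 1600000 in` scoped to the one theorem.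
HONEST LABEL: conditional on the DISPLAYED tower-fixing binders (global `φ` and local `Φ`; cell lemma W2, unrefereed);
nothing asserted on 19804; no stub closed; X12.CMAtTwo NOT proved; BSD is not proved by any of this.
`--supports stmt-BirchSwinnertonDyer-19804 --as helper`.
-/

set_option linter.dupNamespace false
set_option autoImplicit false

noncomputable section

open scoped Classical Pointwise

namespace Summit.BirchSwinnertonDyer.BirchSwinnertonDyer.Theorems.SylvesterTwoCMHalf

open WeierstrassCurve WeierstrassCurve.Affine.Point Field NumberField IsDedekindDomain Finset
open Literature.NumberTheory.EllipticCurves Literature.NumberTheory.GaloisRepresentations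
  Literature.NumberTheory.EllipticCurves.ModularForms
  Literature.NumberTheory.EllipticCurves.HuShuYin2019
  Literature.NumberTheory.EllipticCurves.KolyvaginCocycle
  Summit.BirchSwinnertonDyer.BirchSwinnertonDyer.Theorems.SylvesterTwoCMData
  Summit.BirchSwinnertonDyer.BirchSwinnertonDyer.Theorems.SylvesterTwoCMFlip
  Literature.NumberTheory.EllipticCurves.RingClassField
  Summit.BirchSwinnertonDyer.Rank1Residual.X11b Summit.BirchSwinnertonDyer.Rank1Residual.X11b.RingClassTower

variable {K : Type} [Field K] [NumberField K]

set_option maxHeartbeats 1600000 in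
/-- **The HALF pair class is Selmer at `w ∣ 3` from the LOCAL tower fixing** (k-ty1's coprime-index criterion, one call).
[cite: GrossLMS1991, Prop. 6.2 (1), §12] [cite: McCallumLMS1991, Lemma 4.3] [cite: SerreGaloisCohomology1997, I §2.4 Prop. 9]
[cite: HuShuYin2019, §1 p. 4, §2 p. 8] -/
theorem half_pairClass_mem_selmerLocalKer_three {ω : K} (hω : ω ^ 2 + ω + 1 = 0) (h2 : Module.finrank ℚ K = 2)
    (ι : K →+* ℂ) {p : ℕ} (hp0 : p ≠ 0) {m m₁ m₂ : ℕ} (hm0 : m ≠ 0)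
    (κ : geomPoints ((cubeSumCurve 9).baseChange K) ≃+
      geomPoints ((⟨0, 0, 1, 0, -1⟩ : WeierstrassCurve ℚ).baseChange K))
    (hκG : ∀ (g : absoluteGaloisGroup K) (P : geomPoints ((cubeSumCurve 9).baseChange K)),
      κ (g • P) = g • κ P)
    {vB : AlgebraicClosure K} (hvBc : vB ^ 3 = algebraMap ℚ (AlgebraicClosure K) ((p : ℚ) / 9)) (hvB : vB ≠ 0)
    (hvB3 : ∀ g : absoluteGaloisGroup K,
      ((show AlgebraicClosure K ≃ₐ[K] AlgebraicClosure K from g) vB) ^ 3 = vB ^ 3)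
    {ψB : geomPoints ((cubeSumCurve 9).baseChange K) ≃+ geomPoints ((cubeSumCurve (p : ℚ)).baseChange K)}
    (hψB : ∀ {x y : AlgebraicClosure K}
      (h : (((cubeSumCurve 9).baseChange K).baseChange (AlgebraicClosure K)).toAffine.Nonsingular x y),
      ∃ h', ψB (Affine.Point.some x y h) = Affine.Point.some (vB ^ 2 * x) (vB ^ 3 * y) h')
    {ρ : absoluteGaloisGroup K →
      geomPoints ((cubeSumCurve 9).baseChange K) ≃+ geomPoints ((cubeSumCurve 9).baseChange K)}
    (hρ : ∀ (g : absoluteGaloisGroup K) {x y : AlgebraicClosure K}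
        (h : (((cubeSumCurve 9).baseChange K).baseChange (AlgebraicClosure K)).toAffine.Nonsingular x y),
        ∃ h', ρ g (Affine.Point.some x y h) =
          Affine.Point.some (((show AlgebraicClosure K ≃ₐ[K] AlgebraicClosure K from g) vB / vB) ^ 2 * x)
            y h')
    (emb₀ : ringClassField K ι (9 * p) →+* AlgebraicClosure K)
    {c₃ cp : ringClassField K ι (9 * p)} (hc₃ : c₃ ^ 3 = 3) (hcp : cp ^ 3 = (p : ringClassField K ι (9 * p)))
    {s : ringClassField K ι (9 * p) ≃ₐ[K] ringClassField K ι (9 * p)} (hs3 : s c₃ = c₃) (hsp : s cp = cp)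
    (hle₀2 : ringClassField K ι (9 * p) ≤ ringClassField K ι m)
    (emb : ringClassField K ι m →+* AlgebraicClosure K)
    (hemb : ∀ k : K, emb (algebraMap K (ringClassField K ι m) k) = algebraMap K (AlgebraicClosure K) k)
    (hcoh₀2 : ∀ x : ringClassField K ι (9 * p), emb (RingClassField.inclusion ι hle₀2 x) = emb₀ x)
    (ιe : letI : DecidableEq (ringClassField K ι m) := fun a b ↦ Classical.propDecidable (a = b)
      ((⟨0, 0, 1, 0, -1⟩ : WeierstrassCurve ℚ).baseChange (ringClassField K ι m)).toAffine.Point →+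
        geomPoints ((⟨0, 0, 1, 0, -1⟩ : WeierstrassCurve ℚ).baseChange K))
    (hιe : ∀ P, ιe P = Affine.Point.map (W' := (⟨0, 0, 1, 0, -1⟩ : WeierstrassCurve ℚ)) emb.toRatAlgHom P)
    (N : Subgroup (absoluteGaloisGroup K))
    (hN : ∀ g : absoluteGaloisGroup K, g ∈ N ↔
      ∀ x : ringClassField K ι m, (show AlgebraicClosure K ≃ₐ[K] AlgebraicClosure K from g) (emb x) = emb x)
    {ιt : Type} [Fintype ιt] (t : ιt → absoluteGaloisGroup K)
    {σ σ' : ringClassField K ι m ≃ₐ[ℚ] ringClassField K ι m}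
    (hσ : Subgroup.zpowers σ = ringClassGalOver ι m m₁) (hσ' : Subgroup.zpowers σ' = ringClassGalOver ι m m₂)
    (ℓ ℓ' : ℕ) {y : ((⟨0, 0, 1, 0, -1⟩ : WeierstrassCurve ℚ).baseChange (ringClassField K ι m)).toAffine.Point}
    {hdivB : ∀ P : geomPoints ((cubeSumCurve (p : ℚ)).baseChange K),
      ∃ R : geomPoints ((cubeSumCurve (p : ℚ)).baseChange K), ((2 : ℕ) : ℤ) • R = P}
    (hA₁ : IsAdmissible (absoluteGaloisGroup K)
      ((FixedPoints.addSubgroup N (geomPoints ((cubeSumCurve 9).baseChange K))).map ψB.toAddMonoidHom) ((2 : ℕ) : ℤ))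
    (hP₁ : ψB (∑ i, ρ (t i) (t i • κ.symm (ιe (KolyvaginOperator.derivOp
        (pointGalHom (⟨0, 0, 1, 0, -1⟩ : WeierstrassCurve ℚ) (ringClassField K ι m)) σ ℓ
        (KolyvaginOperator.derivOp (pointGalHom (⟨0, 0, 1, 0, -1⟩ : WeierstrassCurve ℚ) (ringClassField K ι m)) σ' ℓ' y))))) ∈
      invPoints (absoluteGaloisGroup K)
        ((FixedPoints.addSubgroup N (geomPoints ((cubeSumCurve 9).baseChange K))).map ψB.toAddMonoidHom) ((2 : ℕ) : ℤ))
    -- THE TOWER FIXING at this level, GLOBAL part: `φ ∈ Aut_K K[m]` restricting to `s`, fixing `y`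
    (φ : ringClassField K ι m ≃ₐ[K] ringClassField K ι m)
    (hφs : ∀ x : ringClassField K ι (9 * p),
      φ (RingClassField.inclusion ι hle₀2 x) = RingClassField.inclusion ι hle₀2 (s x))
    (hφy : pointGalHom (⟨0, 0, 1, 0, -1⟩ : WeierstrassCurve ℚ) (ringClassField K ι m) (φ.restrictScalars ℚ) y = y)
    -- THE TOWER FIXING at this level, LOCAL part at `w ∣ 3` (W2-a/d; displayed, not proved)
    (v : HeightOneSpectrum (𝓞 K)) (Φ : Subgroup (absoluteGaloisGroup (v.adicCompletion K)))
    (hΦ : IsOpen (Φ : Set (absoluteGaloisGroup (v.adicCompletion K)))) (hcop : IsCoprime (Φ.index : ℤ) ((2 : ℕ) : ℤ))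
    (hΦdich : ∀ τ ∈ Φ,
      (∀ x : ringClassField K ι m, (show AlgebraicClosure K ≃ₐ[K] AlgebraicClosure K from
        resGal (K := K) (v.adicCompletion K) τ) (emb x) = emb x) ∨
      (∀ x : ringClassField K ι m, (show AlgebraicClosure K ≃ₐ[K] AlgebraicClosure K from
        resGal (K := K) (v.adicCompletion K) τ) (emb x) = emb (φ x))) :
    kolyvaginClass ((cubeSumCurve (p : ℚ)).baseChange K) ((2 : ℕ) : ℤ) hdivB hA₁
        (ψB (∑ i, ρ (t i) (t i • κ.symm (ιe (KolyvaginOperator.derivOp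
          (pointGalHom (⟨0, 0, 1, 0, -1⟩ : WeierstrassCurve ℚ) (ringClassField K ι m)) σ ℓ
          (KolyvaginOperator.derivOp (pointGalHom (⟨0, 0, 1, 0, -1⟩ : WeierstrassCurve ℚ) (ringClassField K ι m))
            σ' ℓ' y)))))) hP₁ ∈
      selmerLocalKer ((cubeSumCurve (p : ℚ)).baseChange K) (v.adicCompletion K) ((2 : ℕ) : ℤ) := by
  have hK := JZero.isImaginaryQuadratic_of_sq_add_self_add_one hω h2
  haveI := (finiteDimensional_and_isGalois_ringClassField hK ι hm0).2
  have hcomm := commutator_mem_of_ringClassField hK ι hm0 emb hemb N hN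
  -- the pair point is `N`-fixed
  set P := κ.symm (ιe (KolyvaginOperator.derivOp
    (pointGalHom (⟨0, 0, 1, 0, -1⟩ : WeierstrassCurve ℚ) (ringClassField K ι m)) σ ℓ
    (KolyvaginOperator.derivOp (pointGalHom (⟨0, 0, 1, 0, -1⟩ : WeierstrassCurve ℚ) (ringClassField K ι m))
      σ' ℓ' y))) with hP
  have hPN : ∀ h ∈ N, h • P = P := (JZero.mem_fixedPoints_iff _ N _).mp
    (mem_fixedPoints_symm_of_equivariant κ hκG N
      (map_emb_mem_fixedPoints (⟨0, 0, 1, 0, -1⟩ : WeierstrassCurve ℚ) ι emb ιe hιe N hN _))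
  -- `Φ` fixes `emb₀ ∛3`, `emb₀ ∛p` (both `1` and `φ` do), hence `v_B`
  have hc₃0 : c₃ ≠ 0 := fun h ↦ by rw [h] at hc₃; norm_num at hc₃
  have hcp0 : cp ≠ 0 := fun h ↦ by
    rw [h, zero_pow three_ne_zero] at hcp; exact hp0 (by exact_mod_cast hcp.symm)
  have hw3 : (emb₀ cp / emb₀ c₃ ^ 2) ^ 3 = vB ^ 3 := by
    rw [hvBc, div_pow, ← pow_mul, ← map_pow, ← map_pow, hcp, show 2 * 3 = 3 * 2 from rfl, pow_mul, hc₃,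
      map_natCast, map_pow, map_ofNat, eq_ratCast]
    push_cast; ring
  have hw0 : emb₀ cp / emb₀ c₃ ^ 2 ≠ 0 :=
    div_ne_zero ((map_ne_zero emb₀).mpr hcp0) (pow_ne_zero 2 ((map_ne_zero emb₀).mpr hc₃0))
  have hΦfix : ∀ τ ∈ Φ, ∀ x : ringClassField K ι (9 * p), s x = x →
      (show AlgebraicClosure K ≃ₐ[K] AlgebraicClosure K from resGal (K := K) (v.adicCompletion K) τ) (emb₀ x) =
        emb₀ x := by
    intro τ hτ x hx
    rcases hΦdich τ hτ with h1 | hφ'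
    · rw [← hcoh₀2, h1]
    · rw [← hcoh₀2, hφ', hφs, hx]
  have hΦv : ∀ τ ∈ Φ, (show AlgebraicClosure K ≃ₐ[K] AlgebraicClosure K from
      resGal (K := K) (v.adicCompletion K) τ) vB = vB := fun τ hτ ↦
    JZero.apply_eq_self_of_cubeRoot hω _ hw0 hw3.symm
      (by rw [map_div₀, map_pow, hΦfix τ hτ c₃ hs3, hΦfix τ hτ cp hsp])
  -- `Φ` fixes the pair point (`1` trivially; `φ` by the global fixing)
  have hfin := pointGalHom_derivOp_derivOp_eq_of_apply_eq hK ι hσ hσ' φ ℓ ℓ' hφy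
  have hΦP : ∀ τ ∈ Φ, resGal (K := K) (v.adicCompletion K) τ • P = P := by
    intro τ hτ
    rcases hΦdich τ hτ with h1 | hφ'
    · exact hPN _ ((hN _).mpr h1)
    · exact smul_symm_embPoints_eq_of_apply_eq emb κ hκG ιe hιe (φ.restrictScalars ℚ) hφ' hfin
  exact JZero.kolyvaginClass_cubicTwist_chiComponent_mem_selmerLocalKer_of_isCoprime hω hvB hvB3 hρ hψB N hcomm t
    hA₁ hPN hP₁ Φ hΦ hcop hΦv hΦP

end Summit.BirchSwinnertonDyer.BirchSwinnertonDyer.Theorems.SylvesterTwoCMHalf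

end
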